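import Literature.AnabelianGeometry.SemiGraphs.QuasiTemperoids
import Literature.AnabelianGeometry.SemiGraphs.TemperoidsGaloisObjectsProofs
import Literature.AnabelianGeometry.SemiGraphs.BTempQuotientProofs
import Literature.AnabelianGeometry.SemiGraphs.TemperoidsCountablyConnectedTransport
import Mathlib.GroupTheory.QuotientGroup.Basic
import HarnessLib

/-!
# Semi-graphs of anabelioids, Appendix: quasi-temperoids — the two forms of Definition A.1 (i)

Mochizuki, *Semi-graphs of anabelioids*, Publ. RIMS **42** (2006), Appendix, Definition A.1 (i),
manuscript p. 79 [cite: MochizukiSemiAnbd2006, Def A.1(i) p.79], and its recall in *The geometry of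
Frobenioids II*, Example 1.3 (i), p. 11 ("[cf. [SemiAnbd], Definition A.1, (i)]").  Proof-only
companion of `QuasiTemperoids.lean` (no definitions):

* `isConnectedQuasiTemperoid_iff_nonempty_chart` — the tree's predicate
  `IsConnectedQuasiTemperoid` (`Q ≌ B^temp(Π, Π°)`, `Π` tempered, `Π° ⊆ Π` open) holds iff `Q`
  admits a `ConnectedQuasiTemperoidChart` (`Q ≌ B^temp(Π)[A]`, `A` connected): `B^temp(Π, Π°)` is
  `B^temp(Π)[Π/Π°]` with `Π/Π°` connected, and every connected object of `B^temp(Π)` is a coset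
  object `Π/Stab(x)` with open stabiliser (Rmk. 3.1.2, `BTemp.nonempty_quotientObj_iso_of_isConnectedObj`);
* `isConnectedQuasiTemperoid_of_slice` — Definition A.1 (i) verbatim: a category equivalent to
  `T[A]`, `T` a connected temperoid, `A` connected, is a connected quasi-temperoid;
* `QuasiTemperoidChart.isConnectedQuasiTemperoid_component`, `IsQuasiTemperoid.of_connected` —
  the components of a quasi-temperoid chart are connected quasi-temperoids; a connected
  quasi-temperoid is a quasi-temperoid;
* `IsConnectedTemperoid.isConnectedQuasiTemperoid`, `IsTemperoid.isQuasiTemperoid` — "a certain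
  minor generalization of the notion of a temperoid" (p. 79): (connected) temperoids are (connected)
  quasi-temperoids, `T = T[1]` for the terminal (one-point, connected) object `1 = Π/Π`.

Nothing here takes a side on [IUTchIII] Cor. 3.12; typed ≠ discharged.
-/

open CategoryTheory CategoryTheory.Limits Topology

namespace Literature.AnabelianGeometry.SemiGraphs

open Literature.AlgebraicGeometry.Frobenioids (IsConnectedObj)
open Literature.AlgebraicGeometry.Frobenioids.QuasiTemperoid (IsConnectedQuasiTemperoid BTempRel
  cosetObj)

universe v₁ v₂ u u₁ u₂

variable {Q : Type u₁} [Category.{v₁} Q]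

/-- **Definition A.1 (i) ⟺ its recall [FrdII] Ex. 1.3 (i)** (SemiAnbd Appendix p. 79; FrdII p. 11):
`Q` is a connected quasi-temperoid in the tree's sense (`Q ≌ B^temp(Π, Π°)`) iff `Q ≌ B^temp(Π)[A]`
for a tempered `Π` and a connected object `A`. [cite: MochizukiSemiAnbd2006, Def A.1(i) p.79] -/
theorem isConnectedQuasiTemperoid_iff_nonempty_chart :
    IsConnectedQuasiTemperoid.{v₁, u₁, u} Q ↔
      Nonempty (ConnectedQuasiTemperoidChart.{v₁, u, u₁} Q) := by
  constructor
  · rintro ⟨G, _, _, _, H, hG, hH, ⟨e⟩⟩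
    exact ⟨{ G := G, isTempered := hG, A := cosetObj G hG H hH,
             isConnectedObj := GaloisObjects.isConnectedObj_quotientObj hG H hH,
             equiv := e.trans (bTempRelEquivOverPrime G hG H hH) }⟩
  · rintro ⟨c⟩
    letI : MulAction c.G c.A.obj.V := Action.instMulAction c.A.obj
    obtain ⟨x⟩ := ((BTemp.isConnectedObj_iff c.A).mp c.isConnectedObj).1
    obtain ⟨hHo, ⟨i⟩⟩ := BTemp.nonempty_quotientObj_iso_of_isConnectedObj c.isTempered c.A
      c.isConnectedObj x (MulAction.stabilizer c.G x) (fun g => MulAction.mem_stabilizer_iff)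
    exact ⟨c.G, c.group, c.topologicalSpace, c.isTopologicalGroup, MulAction.stabilizer c.G x,
      c.isTempered, hHo, ⟨(c.equiv.trans (overPrimeCongr i.symm)).trans
        (bTempRelEquivOverPrime c.G c.isTempered _ hHo).symm⟩⟩

/-- **Definition A.1 (i)**, verbatim (SemiAnbd Appendix p. 79): "Any category equivalent to a
category of the form `T[A]` — where `A` is a connected object, and `T` is a connected temperoid —
[is] a *connected quasi-temperoid*": such a category admits a chart (transport `T[A]` along
`T ≌ B^temp(Π)`). [cite: MochizukiSemiAnbd2006, Def A.1(i) p.79] -/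
theorem ConnectedQuasiTemperoidChart.nonempty_of_slice {T : Type u₂} [Category.{v₂} T]
    (cT : ConnectedTemperoidChart.{v₂, u, u₂} T) {A : T} (hA : IsConnectedObj A) (e : Q ≌ Over' A) :
    Nonempty (ConnectedQuasiTemperoidChart.{v₁, u, u₁} Q) :=
  ⟨{ G := cT.G, isTempered := cT.isTempered, A := cT.equiv.functor.obj A,
     isConnectedObj := TemperoidTransport.isConnectedObj_functor_obj cT.equiv hA,
     equiv := e.trans (overPrimeEquivOfEquiv cT.equiv A) }⟩

/-- **Definition A.1 (i)**, verbatim, in terms of the tree's predicate: a category equivalent to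
`T[A]` (`T` a connected temperoid, `A` connected) is a connected quasi-temperoid.
[cite: MochizukiSemiAnbd2006, Def A.1(i) p.79] -/
theorem isConnectedQuasiTemperoid_of_slice {T : Type u₂} [Category.{v₂} T]
    (hT : IsConnectedTemperoid.{v₂, u, u₂} T) {A : T} (hA : IsConnectedObj A)
    (e : Nonempty (Q ≌ Over' A)) : IsConnectedQuasiTemperoid.{v₁, u₁, u} Q := by
  obtain ⟨cT⟩ := hT
  obtain ⟨e⟩ := e
  exact isConnectedQuasiTemperoid_iff_nonempty_chart.mpr
    (ConnectedQuasiTemperoidChart.nonempty_of_slice cT hA e)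

/-- The components of a quasi-temperoid chart are connected quasi-temperoids (Def. A.1 (ii)).
[cite: MochizukiSemiAnbd2006, Def A.1(ii) p.79] -/
theorem QuasiTemperoidChart.isConnectedQuasiTemperoid_component
    (c : QuasiTemperoidChart.{v₁, u, u₁} Q) (i : c.ι) :
    IsConnectedQuasiTemperoid.{u, u + 1, u} (Over' (c.A i)) :=
  isConnectedQuasiTemperoid_iff_nonempty_chart.mpr
    ⟨{ G := c.G i, isTempered := c.isTempered i, A := c.A i, isConnectedObj := c.isConnectedObj i,
       equiv := CategoryTheory.Equivalence.refl }⟩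

/-- A connected quasi-temperoid is a quasi-temperoid (the one-member family; Def. A.1 (ii)).
[cite: MochizukiSemiAnbd2006, Def A.1(ii) p.79] -/
theorem IsQuasiTemperoid.of_connected (h : IsConnectedQuasiTemperoid.{v₁, u₁, u} Q) :
    IsQuasiTemperoid.{v₁, u, u₁} Q := by
  obtain ⟨c⟩ := isConnectedQuasiTemperoid_iff_nonempty_chart.mp h
  exact ⟨{ ι := PUnit, countable := inferInstance, G := fun _ => c.G,
           isTempered := fun _ => c.isTempered, A := fun _ => c.A,
           isConnectedObj := fun _ => c.isConnectedObj,
           equiv := c.equiv.trans (piPUnitEquivalence _).symm }⟩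

/-- "A certain minor generalization of the notion of a temperoid" (Appendix, p. 79): a connected
temperoid `T` is a connected quasi-temperoid — `T = T[1]` for the terminal object `1 = Π/Π` of
`B^temp(Π)`, which is connected. [cite: MochizukiSemiAnbd2006, Def A.1(i) p.79] -/
theorem IsConnectedTemperoid.isConnectedQuasiTemperoid {T : Type u₂} [Category.{v₂} T]
    (hT : IsConnectedTemperoid.{v₂, u, u₂} T) : IsConnectedQuasiTemperoid.{v₂, u₂, u} T := by
  obtain ⟨c⟩ := hT
  have htop : IsOpen ((⊤ : Subgroup c.G) : Set c.G) := isOpen_univ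
  let A : BTemp c.G := BTemp.quotientObj c.G c.isTempered ⊤ htop
  haveI : Subsingleton A.obj.V :=
    (QuotientGroup.subsingleton_quotient_top : Subsingleton (c.G ⧸ (⊤ : Subgroup c.G)))
  -- every object of `B^temp(Π)` maps to the one-point object `A = Π/Π`
  have hall : ∀ X : BTemp c.G, admitsHomTo A X := fun X =>
    ⟨ObjectProperty.homMk
      { hom := TypeCat.ofHom (fun _ => ((1 : c.G) : c.G ⧸ (⊤ : Subgroup c.G)))
        comm := fun g => ConcreteCategory.hom_ext _ _ fun x => Subsingleton.elim _ _ }⟩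
  have hP : admitsHomTo A = (⊤ : ObjectProperty (BTemp c.G)) :=
    funext fun X => propext ⟨fun _ => trivial, fun _ => hall X⟩
  exact isConnectedQuasiTemperoid_iff_nonempty_chart.mpr
    ⟨{ G := c.G, isTempered := c.isTempered, A := A,
       isConnectedObj := GaloisObjects.isConnectedObj_quotientObj c.isTempered ⊤ htop,
       equiv := c.equiv.trans (((ObjectProperty.fullSubcategoryCongr hP).trans
         (ObjectProperty.topEquivalence (BTemp c.G))).symm) }⟩

/-- Likewise a temperoid is a quasi-temperoid: `∏ᵢ B^temp(Πᵢ) ≌ ∏ᵢ B^temp(Πᵢ)[Πᵢ/Πᵢ]`.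
[cite: MochizukiSemiAnbd2006, Def A.1(ii) p.79] -/
theorem IsTemperoid.isQuasiTemperoid {T : Type u₂} [Category.{v₂} T]
    (hT : IsTemperoid.{v₂, u, u₂} T) : IsQuasiTemperoid.{v₂, u, u₂} T := by
  obtain ⟨c⟩ := hT
  have htop : ∀ i, IsOpen ((⊤ : Subgroup (c.G i)) : Set (c.G i)) := fun i => isOpen_univ
  let A : ∀ i, BTemp (c.G i) := fun i => BTemp.quotientObj (c.G i) (c.isTempered i) ⊤ (htop i)
  haveI : ∀ i, Subsingleton (A i).obj.V := fun i =>
    (QuotientGroup.subsingleton_quotient_top : Subsingleton (c.G i ⧸ (⊤ : Subgroup (c.G i))))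
  have hall : ∀ i (X : BTemp (c.G i)), admitsHomTo (A i) X := fun i X =>
    ⟨ObjectProperty.homMk
      { hom := TypeCat.ofHom (fun _ => ((1 : c.G i) : c.G i ⧸ (⊤ : Subgroup (c.G i))))
        comm := fun g => ConcreteCategory.hom_ext _ _ fun x => Subsingleton.elim _ _ }⟩
  have hP : ∀ i, admitsHomTo (A i) = (⊤ : ObjectProperty (BTemp (c.G i))) := fun i =>
    funext fun X => propext ⟨fun _ => trivial, fun _ => hall i X⟩
  exact ⟨{ ι := c.ι, countable := c.countable, G := c.G, isTempered := c.isTempered, A := A,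
           isConnectedObj := fun i =>
             GaloisObjects.isConnectedObj_quotientObj (c.isTempered i) ⊤ (htop i),
           equiv := c.equiv.trans (Equivalence.pi fun i =>
             ((ObjectProperty.fullSubcategoryCongr (hP i)).trans
               (ObjectProperty.topEquivalence (BTemp (c.G i)))).symm) }⟩

end Literature.AnabelianGeometry.SemiGraphs
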